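import Literature.AlgebraicGeometry.Resolution.BlowupChartQuasiRegular
import Mathlib.RingTheory.Polynomial.Quotient
import Mathlib.RingTheory.Ideal.Quotient.Operations
import HarnessLib

/-!
# The exceptional chart of the blow-up of a hypersurface point is a chart of its tangent cone

Support file for crux stmt-ResolutionOfSingularities-15316 (`FrobeniusLadder.FRationalModification`, line
`socle-discrepancy-certificate`, stub `stub_maxMultiplicityCertificate`).

Let `R` be a commutative ring, `x = (x₀, …, x_{r-1})`, `I = (x)`, and `D₊(x_i t) = Spec B`,
`B = (R[It])_{(x_i t)}`, the chart of the blowing up `Bl_I(Spec R) = Proj R[It]` at the generator `x_i`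
(`AffineBlowup.lean`; `φ : R → B`, exceptional equation `φ(x_i)`, generators `e_j = (x_j t)/(x_i t)`,
`B = R[e_j : j ≠ i]`, `BlowupChartQuasiRegular.lean`). Suppose the relations of the associated graded ring
`gr_I(R) = ⊕ Iⁿ/Iⁿ⁺¹` over `(R/I)[T₀, …, T_{r-1}]` are generated by ONE form: there is a form `F ∈ R[T]` of
degree `D` with `F(x) = 0` such that every form `H` of degree `N` with `H(x) ∈ I^{N+1}` is `≡ F·G`
modulo `I·R[T]` (hypothesis `hrel`; for a hypersurface `R = S/(f)` in a regular local ring with `f` of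
order `D` this is `…MaxMultiplicityCertificateInitialForm.exists_sub_mul_mem_map`, `F` a lift of the
initial form of `f`). Then **the exceptional divisor of the chart is the corresponding chart of the
tangent cone `Proj (R/I)[T]/(F̄)`:**

  `B ⧸ (φ x_i) ≅ (R/I)[T_j : j ≠ i] ⧸ (F̄(T_i := 1))`

(`nonempty_ringEquiv_quotient_chart`), via the kernel computation `ker_quotient_comp_eval₂Hom_eq`:
the kernel of `R[T_j : j ≠ i] → B → B/(φ x_i)`, `T_j ↦ e_j`, is `I·R[T] + (F(T_i := 1))`. The proof is
that of the quasi-regular case (`Literature…BlowupChartQuasiRegular.ker_quotient_comp_eval₂Hom_eq`, where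
the kernel is `I·R[T]`) with quasi-regularity replaced by `hrel`: if `P(e) ∈ (φ x_i)`, homogenize `P` to a
form `G`; clearing denominators, `T_i^{k+m} G` evaluates at `x` into `I^{deg+1}`, so it is `≡ F·G'`
modulo `I·R[T]`, and killing `T_i` gives `P ∈ I·R[T] + (F(T_i := 1))`.

References: The Stacks Project, Tag 052P (affine blowup algebras), Tag 0804; U. Görtz, T. Wedhorn,
*Algebraic Geometry I*, (13.19) and Example 13.95 (exceptional divisor = `Proj` of the associated graded
/ normal cone). [folklore]
-/

-- single-problem summit: the doubled namespace component is forced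
set_option linter.dupNamespace false

noncomputable section

namespace Summit.ResolutionOfSingularities.ResolutionOfSingularities.Theorems.FRationalModification.MaxMultiplicityCertificateTangentChart

open Polynomial HomogeneousLocalization Literature.AlgebraicGeometry.Resolution

variable {R : Type} [CommRing R] {r : ℕ} (x : Fin r → R) (i : Fin r)

local notation3 "I" => Ideal.span (Set.range x)
local notation3 "B" => HomogeneousLocalization.Away (reesGrading I)
  (reesT (x i) (Ideal.mem_span_range_self (f := x) (x := i)))
local notation3 "φ" => reesChartBase (x i) (Ideal.mem_span_range_self (f := x) (x := i))
local notation3 "e[" j "]" =>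
  HomogeneousLocalization.Away.mk (reesGrading I) (reesT_mem (x i) (Ideal.mem_span_range_self (f := x) (x := i))) 1
    (reesT (x j) (Ideal.mem_span_range_self (f := x) (x := j))) (reesT_mem_one_smul x j)
/-- Killing the variable `T_i` (`T_i ↦ 1`, `T_j ↦ T_j`). -/
local notation3 "kill" => fun j : Fin r =>
  if h : j = i then (1 : MvPolynomial {j : Fin r // j ≠ i} R) else MvPolynomial.X ⟨j, h⟩

/-- Killing `T_i` fixes the coefficients: `kill ∘ C = C`. [folklore] -/
theorem aeval_kill_comp_C :
    (MvPolynomial.aeval kill : MvPolynomial (Fin r) R →ₐ[R]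
        MvPolynomial {j : Fin r // j ≠ i} R).toRingHom.comp MvPolynomial.C = MvPolynomial.C := by
  refine RingHom.ext fun c => ?_
  change MvPolynomial.aeval kill (MvPolynomial.C c) = MvPolynomial.C c
  rw [MvPolynomial.algHom_C, MvPolynomial.algebraMap_eq]

/-- **A form vanishing at `x` dies on the chart**: if `F` is a form of degree `D` with `F(x) = 0`, then
`F(e) = φ(0)` in `B` (`φ(F(x)) = φ(x_i)^D F(e)` and `φ(x_i)` is a non-zero-divisor), hence `(kill F)(e)`
lies in every ideal, in particular in `(φ x_i)`. [folklore] -/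
theorem eval₂Hom_aeval_kill_mem {D : ℕ} {F : MvPolynomial (Fin r) R} (hF : F.IsHomogeneous D)
    (hF0 : MvPolynomial.eval x F = 0) :
    MvPolynomial.eval₂Hom φ (fun j : {j : Fin r // j ≠ i} => e[j.1]) (MvPolynomial.aeval kill F) ∈
      Ideal.span {φ (x i)} := by
  have h1 := reesChartBase_eval_eq_pow_mul_eval₂ x i hF
  have hnzd : φ (x i) ^ D ∈ nonZeroDivisors B :=
    pow_mem (reesChartBase_mem_nonZeroDivisors (x i) (Ideal.mem_span_range_self (f := x) (x := i))) D
  have h : φ (x i) ^ D * MvPolynomial.eval₂Hom φ (fun j => e[j]) F = φ (x i) ^ D * φ 0 :=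
    calc φ (x i) ^ D * MvPolynomial.eval₂Hom φ (fun j => e[j]) F = φ (MvPolynomial.eval x F) := h1.symm
      _ = φ (x i ^ D * 0) := by rw [hF0, mul_zero]
      _ = φ (x i) ^ D * φ 0 := by rw [map_mul, map_pow]
  have h2 : MvPolynomial.eval₂Hom φ (fun j => e[j]) F = φ 0 := (mul_cancel_left_mem_nonZeroDivisors hnzd).mp h
  have h3 : MvPolynomial.eval₂Hom φ (fun j : {j : Fin r // j ≠ i} => e[j.1]) (MvPolynomial.aeval kill F) =
      φ 0 := by
    rw [← h2, ← eval₂Hom_comp_aeval_kill x i]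
    rfl
  rw [h3, map_zero]
  exact Ideal.zero_mem _

/-- **The relations on the exceptional chart** (hypersurface-type associated graded ring): if the degree-`N`
forms `H` with `H(x) ∈ I^{N+1}` are exactly the `F·G` modulo `I·R[T]` for a fixed form `F` of degree `D`
with `F(x) = 0`, then the kernel of `R[T_j : j ≠ i] → (R[It])_{(x_i t)} / (φ x_i)`, `T_j ↦ (x_j t)/(x_i t)`,
is `I·R[T] + (F(T_i := 1))`. [folklore; cf. StacksProject Tag 052P] -/
theorem ker_quotient_comp_eval₂Hom_eq {D : ℕ} {F : MvPolynomial (Fin r) R} (hF : F.IsHomogeneous D)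
    (hF0 : MvPolynomial.eval x F = 0)
    (hrel : ∀ (N : ℕ) (H : MvPolynomial (Fin r) R), H.IsHomogeneous N →
      MvPolynomial.eval x H ∈ I ^ (N + 1) →
        ∃ G : MvPolynomial (Fin r) R, H - F * G ∈ Ideal.map MvPolynomial.C I) :
    RingHom.ker ((Ideal.Quotient.mk (Ideal.span {φ (x i)})).comp
      (MvPolynomial.eval₂Hom φ (fun j : {j : Fin r // j ≠ i} => e[j.1]))) =
      Ideal.map MvPolynomial.C I ⊔ Ideal.span {MvPolynomial.aeval kill F} := by
  classical
  -- killing `T_i` preserves `I · R[T]`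
  have hkillC := aeval_kill_comp_C (R := R) i
  apply le_antisymm
  · intro P hP
    rw [RingHom.mem_ker, RingHom.comp_apply, Ideal.Quotient.eq_zero_iff_mem,
      Ideal.mem_span_singleton'] at hP
    obtain ⟨z, hz⟩ := hP
    -- homogenize `P` with `T_i` to a form `G` of degree `n`
    set P' : MvPolynomial (Fin r) R := MvPolynomial.rename Subtype.val P with hP'
    set n := P'.totalDegree with hn
    set G : MvPolynomial (Fin r) R := ∑ d ∈ Finset.range (n + 1),
      MvPolynomial.X i ^ (n - d) * MvPolynomial.homogeneousComponent d P' with hG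
    have hGhom : G.IsHomogeneous n := by
      refine MvPolynomial.IsHomogeneous.sum _ _ _ fun d hd => ?_
      have hdn : n - d + d = n :=
        Nat.sub_add_cancel (Nat.lt_succ_iff.mp (Finset.mem_range.mp hd))
      have := (MvPolynomial.isHomogeneous_X_pow i (n - d)).mul
        (MvPolynomial.homogeneousComponent_isHomogeneous d P')
      rwa [hdn] at this
    -- `G(e) = P(e)`
    have hGe : MvPolynomial.eval₂Hom φ (fun j => e[j]) G =
        MvPolynomial.eval₂Hom φ (fun j : {j : Fin r // j ≠ i} => e[j.1]) P := by
      rw [hG, map_sum]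
      have : ∀ d ∈ Finset.range (n + 1), MvPolynomial.eval₂Hom φ (fun j => e[j])
          (MvPolynomial.X i ^ (n - d) * MvPolynomial.homogeneousComponent d P') =
          MvPolynomial.eval₂Hom φ (fun j => e[j]) (MvPolynomial.homogeneousComponent d P') := by
        intro d _
        rw [map_mul, map_pow, MvPolynomial.eval₂Hom_X']
        exact chartGen_self_pow_mul x i _ _
      rw [Finset.sum_congr rfl this, ← map_sum, MvPolynomial.sum_homogeneousComponent, hP',
        MvPolynomial.eval₂Hom_rename]
      rfl
    -- the element `z = (y tᵐ)/(x_i t)ᵐ`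
    obtain ⟨m, p, hp, rfl⟩ := HomogeneousLocalization.Away.mk_surjective (reesGrading I)
      (reesT_mem (x i) (Ideal.mem_span_range_self (f := x) (x := i))) z
    obtain ⟨y, hy⟩ := (mem_reesGrading_iff I).mp hp
    have hm : m • (1 : ℕ) = m := by rw [smul_eq_mul, mul_one]
    rw [hm] at hy
    have hyI : y ∈ I ^ m := reesAlgebra.monomial_mem.mp (hy ▸ p.2)
    have h5 := reesChartBase_eq_pow_mul_mk x i hp hy.symm
    have h3 := reesChartBase_eval_eq_pow_mul_eval₂ x i hGhom
    -- `φ (x_iᵐ G(x) - x_iⁿ⁺¹ y) = 0`, so `x_iᵏ (x_iᵐ G(x) - x_iⁿ⁺¹ y) = 0` for some `k`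
    have hφeq : φ (x i ^ m * MvPolynomial.eval x G - x i ^ (n + 1) * y) = 0 := by
      rw [map_sub, map_mul, map_mul, map_pow, map_pow, h3, hGe, ← hz, h5]
      ring
    obtain ⟨k, hk⟩ := exists_pow_mul_eq_zero_of_reesChartBase_eq_zero x i hφeq
    -- the form `H = T_i^(k+m) G` of degree `k+m+n` has `H(x) ∈ I^(k+m+n+1)`
    set H : MvPolynomial (Fin r) R := MvPolynomial.X i ^ (k + m) * G with hH
    have hHhom : H.IsHomogeneous (k + m + n) :=
      (MvPolynomial.isHomogeneous_X_pow i (k + m)).mul hGhom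
    have hHx : MvPolynomial.eval x H ∈ I ^ (k + m + n + 1) := by
      have e1 : MvPolynomial.eval x H = x i ^ k * x i ^ (n + 1) * y := by
        rw [mul_sub, sub_eq_zero, ← mul_assoc, ← pow_add, ← mul_assoc, ← pow_add] at hk
        rw [hH, map_mul, map_pow, MvPolynomial.eval_X, hk, pow_add]
      rw [e1, show k + m + n + 1 = k + (n + 1) + m by ring, pow_add, pow_add]
      exact Ideal.mul_mem_mul (Ideal.mul_mem_mul (Ideal.pow_mem_pow (Ideal.mem_span_range_self (f := x) (x := i)) k)
        (Ideal.pow_mem_pow (Ideal.mem_span_range_self (f := x) (x := i)) (n + 1))) hyI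
    -- the relation: `H ≡ F · G'` modulo `I · R[T]`
    obtain ⟨G', hG'⟩ := hrel (k + m + n) H hHhom hHx
    -- kill `T_i`: `P = H(T_i := 1)`
    have hPH : P = MvPolynomial.aeval kill H := by
      rw [hH, map_mul, map_pow, MvPolynomial.aeval_X, dif_pos rfl, one_pow, one_mul, hG, map_sum]
      have : ∀ d ∈ Finset.range (n + 1), MvPolynomial.aeval kill
          (MvPolynomial.X i ^ (n - d) * MvPolynomial.homogeneousComponent d P') =
          MvPolynomial.aeval kill (MvPolynomial.homogeneousComponent d P') := by
        intro d _
        rw [map_mul, map_pow, MvPolynomial.aeval_X, dif_pos rfl, one_pow, one_mul]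
      rw [Finset.sum_congr rfl this, ← map_sum, MvPolynomial.sum_homogeneousComponent, hP',
        MvPolynomial.aeval_rename]
      have hfun : ((kill) ∘ (Subtype.val : {j : Fin r // j ≠ i} → Fin r)) = MvPolynomial.X := by
        funext j
        change (kill) j.1 = _
        exact dif_neg j.2
      rw [hfun, MvPolynomial.aeval_X_left_apply]
    have h1 : MvPolynomial.aeval kill H - MvPolynomial.aeval kill F * MvPolynomial.aeval kill G' ∈
        Ideal.map MvPolynomial.C (Ideal.span (Set.range x)) := by
      have h0 := Ideal.mem_map_of_mem (MvPolynomial.aeval kill : MvPolynomial (Fin r) R →ₐ[R]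
        MvPolynomial {j : Fin r // j ≠ i} R).toRingHom hG'
      rw [Ideal.map_map, hkillC] at h0
      simpa only [map_sub, map_mul, AlgHom.toRingHom_eq_coe, RingHom.coe_coe] using h0
    rw [hPH, show MvPolynomial.aeval kill H = (MvPolynomial.aeval kill H -
      MvPolynomial.aeval kill F * MvPolynomial.aeval kill G') +
      MvPolynomial.aeval kill F * MvPolynomial.aeval kill G' by ring]
    exact Submodule.add_mem_sup h1 (Ideal.mul_mem_right _ _ (Ideal.mem_span_singleton_self _))
  · refine sup_le ?_ ?_
    · rw [Ideal.map_le_iff_le_comap]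
      intro c hc
      rw [Ideal.mem_comap, RingHom.mem_ker, RingHom.comp_apply, MvPolynomial.eval₂Hom_C,
        Ideal.Quotient.eq_zero_iff_mem]
      exact reesChartBase_mem_span_of_mem x i hc
    · rw [Ideal.span_singleton_le_iff_mem, RingHom.mem_ker, RingHom.comp_apply,
        Ideal.Quotient.eq_zero_iff_mem]
      exact eval₂Hom_aeval_kill_mem x i hF hF0

/-- The inverse of `MvPolynomial.quotientEquivQuotientMvPolynomial` is reduction of coefficients:
`R[T]/(I R[T]) → (R/I)[T]`, `q̄ ↦ q mod I`. [folklore] -/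
theorem quotientEquivQuotientMvPolynomial_symm_mk {σ : Type} (K : Ideal R) (q : MvPolynomial σ R) :
    (MvPolynomial.quotientEquivQuotientMvPolynomial K).symm (Ideal.Quotient.mk _ q) =
      MvPolynomial.map (Ideal.Quotient.mk K) q := by
  rw [AlgEquiv.symm_apply_eq]
  change ((Ideal.Quotient.mk (Ideal.map MvPolynomial.C K)) : MvPolynomial σ R →+* _) q =
    ((MvPolynomial.quotientEquivQuotientMvPolynomial K).toAlgHom.toRingHom.comp
      (MvPolynomial.map (Ideal.Quotient.mk K))) q
  congr 1
  refine MvPolynomial.ringHom_ext (fun c => ?_) (fun j => ?_)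
  · simp [MvPolynomial.quotientEquivQuotientMvPolynomial]
  · simp [MvPolynomial.quotientEquivQuotientMvPolynomial]

/-- **The exceptional chart is a chart of the tangent cone**: under the hypothesis of
`ker_quotient_comp_eval₂Hom_eq` (the relations of `gr_I(R)` are generated by one form `F` of degree `D`,
`F(x) = 0`), the chart ring of `Bl_I(Spec R)` at `x_i t` modulo the exceptional equation `φ(x_i)` is the
dehomogenized tangent cone `(R/I)[T_j : j ≠ i] ⧸ (F̄(T_i := 1))`, `F̄ = F mod I`.
[folklore; cf. Görtz–Wedhorn Example 13.95] -/
theorem nonempty_ringEquiv_quotient_chart {D : ℕ} {F : MvPolynomial (Fin r) R} (hF : F.IsHomogeneous D)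
    (hF0 : MvPolynomial.eval x F = 0)
    (hrel : ∀ (N : ℕ) (H : MvPolynomial (Fin r) R), H.IsHomogeneous N →
      MvPolynomial.eval x H ∈ I ^ (N + 1) →
        ∃ G : MvPolynomial (Fin r) R, H - F * G ∈ Ideal.map MvPolynomial.C I) :
    Nonempty ((MvPolynomial {j : Fin r // j ≠ i} (R ⧸ I) ⧸
        Ideal.span {MvPolynomial.map (Ideal.Quotient.mk I) (MvPolynomial.aeval kill F)}) ≃+*
      B ⧸ Ideal.span {φ (x i)}) := by
  set J : Ideal (MvPolynomial {j : Fin r // j ≠ i} R) := Ideal.span {MvPolynomial.aeval kill F} with hJ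
  -- `B/(φ x_i) ≅ R[T]/(I R[T] + J)`
  let e1 : (MvPolynomial {j : Fin r // j ≠ i} R ⧸ (Ideal.map MvPolynomial.C I ⊔ J)) ≃+*
      B ⧸ Ideal.span {φ (x i)} :=
    (Ideal.quotEquivOfEq (ker_quotient_comp_eval₂Hom_eq x i hF hF0 hrel).symm).trans
      (RingHom.quotientKerEquivOfSurjective (quotient_comp_eval₂Hom_surjective x i))
  -- `R[T]/(I R[T] + J) ≅ (R[T]/I R[T])/J ≅ (R/I)[T]/(F̄(T_i := 1))`
  let e0 : (MvPolynomial {j : Fin r // j ≠ i} R ⧸ Ideal.map MvPolynomial.C I) ≃+*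
      MvPolynomial {j : Fin r // j ≠ i} (R ⧸ I) :=
    (MvPolynomial.quotientEquivQuotientMvPolynomial I).symm.toRingEquiv
  have he0 : Ideal.span {MvPolynomial.map (Ideal.Quotient.mk I) (MvPolynomial.aeval kill F)} =
      Ideal.map (e0 : _ →+* _) (J.map (Ideal.Quotient.mk (Ideal.map MvPolynomial.C I))) := by
    rw [hJ, Ideal.map_span (Ideal.Quotient.mk (Ideal.map MvPolynomial.C I)), Set.image_singleton,
      Ideal.map_span (s := {(Ideal.Quotient.mk (Ideal.map MvPolynomial.C I)) (MvPolynomial.aeval kill F)}),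
      Set.image_singleton]
    exact congrArg (fun q => Ideal.span {q}) (quotientEquivQuotientMvPolynomial_symm_mk I _).symm
  let e2 : ((MvPolynomial {j : Fin r // j ≠ i} R ⧸ Ideal.map MvPolynomial.C I) ⧸
      J.map (Ideal.Quotient.mk (Ideal.map MvPolynomial.C I))) ≃+*
      (MvPolynomial {j : Fin r // j ≠ i} (R ⧸ I) ⧸
        Ideal.span {MvPolynomial.map (Ideal.Quotient.mk I) (MvPolynomial.aeval kill F)}) :=
    Ideal.quotientEquiv _ _ e0 he0
  exact ⟨e2.symm.trans ((DoubleQuot.quotQuotEquivQuotSup _ _).trans e1)⟩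

/-! ## Registered form -/

/-- **The exceptional chart of the blow-up is a chart of the tangent cone** (registered helper-stub form,
fully explicit binders; = `nonempty_ringEquiv_quotient_chart`): `I = (x₀, …, x_{r-1}) ⊆ R`; if the
relations of `gr_I(R)` are the multiples of one form `F` of degree `D` with `F(x) = 0`, then
`(R[It])_{(x_i t)} ⧸ (x_i/1) ≅ (R/I)[T_j : j ≠ i] ⧸ (F̄(T_i := 1))`. [folklore; Görtz–Wedhorn Ex. 13.95] -/
theorem tangentConeChart_ringEquiv (R : Type) [CommRing R] (r : ℕ) (x : Fin r → R) (i : Fin r) (D : ℕ)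
    (F : MvPolynomial (Fin r) R) (hF : F.IsHomogeneous D) (hF0 : MvPolynomial.eval x F = 0)
    (hrel : ∀ (N : ℕ) (H : MvPolynomial (Fin r) R), H.IsHomogeneous N →
      MvPolynomial.eval x H ∈ Ideal.span (Set.range x) ^ (N + 1) →
        ∃ G : MvPolynomial (Fin r) R, H - F * G ∈ Ideal.map MvPolynomial.C (Ideal.span (Set.range x))) :
    Nonempty ((MvPolynomial {j : Fin r // j ≠ i} (R ⧸ Ideal.span (Set.range x)) ⧸
        Ideal.span {MvPolynomial.map (Ideal.Quotient.mk (Ideal.span (Set.range x)))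
          (MvPolynomial.aeval (fun j : Fin r => if h : j = i then
            (1 : MvPolynomial {j : Fin r // j ≠ i} R) else MvPolynomial.X ⟨j, h⟩) F)}) ≃+*
      HomogeneousLocalization.Away (Literature.AlgebraicGeometry.Resolution.reesGrading (Ideal.span (Set.range x)))
          (Literature.AlgebraicGeometry.Resolution.reesT (x i) (Ideal.subset_span (Set.mem_range_self i))) ⧸
        Ideal.span {Literature.AlgebraicGeometry.Resolution.reesChartBase (x i)
          (Ideal.subset_span (Set.mem_range_self i)) (x i)}) :=
  nonempty_ringEquiv_quotient_chart x i hF hF0 hrel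

end Summit.ResolutionOfSingularities.ResolutionOfSingularities.Theorems.FRationalModification.MaxMultiplicityCertificateTangentChart

end
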